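import Summits.Ventures.YMGap.Conjectures.StrongCouplingGaussianCorrectedCertAllColoursPlayers
import HarnessLib
import HarnessLib.Audit.Tags

/-!
# The Gaussian-corrected crossing factor of the `U(N)` theory is a sum of hermitian squares, for
# EVERY number of colours `N` (2/2): the certificate `HermSqCert N (1/4N)`

Cell `pub-ymgap`, seat qcd-lit g22 (literature-prover), `bears_on: Q1` (typed node
`SalmhoferSeilerSmallBeta`).  Everything is a theorem / explicit definition (0 facts, 0 sorry).

With the one-colour and one-pair identities of `…CertAllColoursPlayers`:
`exp(½∑_k b_k) exp(−(1/4N) MΘM') = exp(∑_{(c,d)} q_{cd} + ∑_c u_c) = ∏_{(c,d)}↑ exp q_{cd} · ∏_c↑ exp u_c`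
`= ∏_{(c,d)}↑ [∑_{p<3} (η^p/p!) L_{cd}^p ΘL'^p_{cd}] · ∏_c↑ [1 + ½X_{c,ψ̄}ΘX'_{c,ψ̄} + ½X_{c,ψ}ΘX'_{c,ψ}]`, and
products of two-field sums of hermitian squares of homogeneous elements are sums of hermitian squares
(`mul_map_mul_prod_hermSq`).  **`cert_identity`, `hermSqCert`**: the explicit certificate
`HermSqCert N (1/4N) (Idx N)` for every `N ≥ 1` — Salmhofer–Seiler's Remark 4.5 "at `β > 0`" in the
matrix form consumed by `gaussCorrectedN_reflection_positivity`, all colours at once.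

Honest framing: an algebraic identity for one link; its consequences (reflection positivity of the
`β`-dressed background weight for every plane, the infrared bound (IR)_{β,4N} and the conjuncts of
`SalmhoferSeilerSmallBeta`) are drawn in `…ChiralLROMesonWeightInfraredBoundN` / `…ChiralLROAllColours`;
nothing about the continuum or the summit's `QCD` conjunct.

## References
* [SalmhoferSeiler1991] M. Salmhofer, E. Seiler, Commun. Math. Phys. 139 (1991) 395–432, Remark 4.5.
* [OsterwalderSeilerAnnPhys1978] K. Osterwalder, E. Seiler, Ann. Phys. 110 (1978) 440–471, §3.
* [Berezin1966] F. A. Berezin, The Method of Second Quantization, Academic Press 1966, Ch. I §3.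
-/

noncomputable section

open scoped ComplexConjugate BigOperators
open Literature.MathematicalPhysics.QuantumLattice
open Literature.MathematicalPhysics.QuantumLattice.GrassmannAlgebra
open Literature.MathematicalPhysics.QuantumLattice.StaggeredRP

namespace Summit.Ventures.YMGap.Conjectures

namespace GaussCorrAllColours

variable {N : ℕ}

section Identity

variable {ι : Type} (Θ : Reflection ι) (X Y : EdgeKey N → GrassmannAlgebra ℂ ι)
variable (hX : ∀ k, ∃ v, X k = ExteriorAlgebra.ι ℂ v) (hY : ∀ k, ∃ v, Y k = ExteriorAlgebra.ι ℂ v)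
include hX hY


/-! #### Nilpotency bookkeeping -/

/-- `∑_c u_c` is nilpotent. [cite: Berezin1966, Ch. I §3] -/
theorem isNilpotent_sum_uu : IsNilpotent (∑ c, uu Θ X Y c) := by
  have hmem : ∀ c, uu Θ X Y c ∈ evenOdd ℂ (ι := ι) 0 := fun c =>
    Submodule.sub_mem _ (Submodule.add_mem _ (Submodule.smul_mem _ _ (bb_mem Θ X Y hX hY _))
      (Submodule.smul_mem _ _ (bb_mem Θ X Y hX hY _))) (Submodule.smul_mem _ _ (TT_mem Θ X Y hX hY _ _))
  exact Commute.isNilpotent_sum (fun c _ => ⟨3, (grassmannExp_uu Θ X Y hX hY c).1⟩)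
    fun i _ _ _ => commute_of_mem_evenOdd_zero ℂ (hmem i) _

/-- `u_c` is even. [cite: Berezin1966, Ch. I §3] -/
theorem uu_mem (c : Fin N) : uu Θ X Y c ∈ evenOdd ℂ (ι := ι) 0 :=
  Submodule.sub_mem _ (Submodule.add_mem _ (Submodule.smul_mem _ _ (bb_mem Θ X Y hX hY _))
    (Submodule.smul_mem _ _ (bb_mem Θ X Y hX hY _))) (Submodule.smul_mem _ _ (TT_mem Θ X Y hX hY _ _))

/-- `q_{cd}` is even. [cite: Berezin1966, Ch. I §3] -/
theorem qq_mem (π : Fin N × Fin N) : qq Θ X Y π ∈ evenOdd ℂ (ι := ι) 0 :=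
  Submodule.smul_mem _ _ (mul_mem_evenOdd_zero ℂ (LL_mem X hX π) (Θ.map_mem_evenOdd (LL_mem Y hY π)))

/-- `∑ q_{cd}` is nilpotent. [cite: Berezin1966, Ch. I §3] -/
theorem isNilpotent_sum_qq : IsNilpotent (∑ i : Fin (N * N), qq Θ X Y (pairOf i)) :=
  Commute.isNilpotent_sum (fun _ _ => ⟨3, (grassmannExp_qq Θ X Y hX _).1⟩)
    fun _ _ _ _ => commute_of_mem_evenOdd_zero ℂ (qq_mem Θ X Y hX hY _) _

omit hX hY in
/-- `exp` of a `Fin n`-indexed sum of even nilpotent elements is the ordered product of the `exp`s. [cite: Berezin1966, Ch. I §3] -/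
theorem grassmannExp_sum_ofFn {n : ℕ} (f : Fin n → GrassmannAlgebra ℂ ι)
    (hf : ∀ i, f i ∈ evenOdd ℂ (ι := ι) 0) (hn : ∀ i, IsNilpotent (f i)) :
    grassmannExp (∑ i, f i) = (List.ofFn fun i => grassmannExp (f i)).prod := by
  induction n with
  | zero => simp [grassmannExp, IsNilpotent.exp_zero]
  | succ n ih =>
    rw [Fin.sum_univ_succ, List.ofFn_succ, List.prod_cons, ← ih (fun i => f i.succ) (fun i => hf _) (fun i => hn _),
      grassmannExp, grassmannExp, grassmannExp,
      IsNilpotent.exp_add_of_commute (Commute.sum_right _ _ _ fun j _ => commute_of_mem_evenOdd_zero ℂ (hf 0) _) (hn 0)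
        (Commute.isNilpotent_sum (fun j _ => hn j.succ) fun i _ _ _ => commute_of_mem_evenOdd_zero ℂ (hf i.succ) _)]

/-! ### The certificate identity -/

/-- **THE STRUCTURE THEOREM**: `exp(½∑_k X_kΘX'_k) · exp(−(1/4N) MΘM') = ∑_j λ_j A_j(X) ΘA_j(X')` with
the explicit data `lam, elem` — for every `N ≥ 1`, every complex Grassmann algebra, every antilinear
reflection and all degree-one families. [cite: SalmhoferSeiler1991, Remark 4.5] -/
theorem cert_identity (hN : N ≠ 0) :
    grassmannExp (∑ k, (1 / 2 : ℂ) • (X k * Θ (Y k))) *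
        grassmannExp (-(((1 / (4 * N) : ℝ)) : ℂ) • (evalF X (mesonF N) * Θ (evalF Y (mesonF N)))) =
      ∑ j : Idx N, (lam j : ℂ) • (evalF X (elem j) * Θ (evalF Y (elem j))) := by
  -- nilpotency of the two exponents
  have hE₁mem : ∑ k, (1 / 2 : ℂ) • (X k * Θ (Y k)) ∈ evenOdd ℂ (ι := ι) 0 :=
    Submodule.sum_mem _ fun k _ => Submodule.smul_mem _ _ (bb_mem Θ X Y hX hY k)
  have hE₁nil : IsNilpotent (∑ k, (1 / 2 : ℂ) • (X k * Θ (Y k))) :=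
    Commute.isNilpotent_sum
      (fun k _ => (show IsNilpotent (bb Θ X Y k) from ⟨2, by rw [pow_two, bb_mul_self Θ X Y hX hY]⟩).smul _)
      fun i _ _ _ => commute_of_mem_evenOdd_zero ℂ (Submodule.smul_mem _ _ (bb_mem Θ X Y hX hY i)) _
  have hMmem : evalF X (mesonF N) ∈ evenOdd ℂ (ι := ι) 0 := by
    rw [evalF_mesonF']; exact Submodule.sum_mem _ fun c _ => mm_mem X hX c
  have hMnil : IsNilpotent (evalF X (mesonF N)) := by
    rw [evalF_mesonF']
    exact Commute.isNilpotent_sum (fun c _ => ⟨2, by rw [pow_two, mm_mul_self X hX]⟩)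
      fun i _ _ _ => commute_of_mem_evenOdd_zero ℂ (mm_mem X hX i) _
  have hE₂nil : IsNilpotent (-(((1 / (4 * N) : ℝ)) : ℂ) • (evalF X (mesonF N) * Θ (evalF Y (mesonF N)))) :=
    ((commute_of_mem_evenOdd_zero ℂ hMmem _).isNilpotent_mul_right hMnil).smul _
  -- merge, re-split
  rw [grassmannExp, grassmannExp, ← IsNilpotent.exp_add_of_commute (commute_of_mem_evenOdd_zero ℂ hE₁mem _) hE₁nil hE₂nil,
    exponent_eq Θ X Y hN,
    IsNilpotent.exp_add_of_commute
      (Commute.sum_left _ _ _ fun i _ => commute_of_mem_evenOdd_zero ℂ (qq_mem Θ X Y hX hY _) _)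
      (isNilpotent_sum_qq Θ X Y hX hY) (isNilpotent_sum_uu Θ X Y hX hY)]
  change grassmannExp (∑ i : Fin (N * N), qq Θ X Y (pairOf i)) * grassmannExp (∑ c, uu Θ X Y c) = _
  rw [grassmannExp_sum_ofFn _ (fun i => qq_mem Θ X Y hX hY _) (fun i => ⟨3, (grassmannExp_qq Θ X Y hX _).1⟩),
    grassmannExp_sum_ofFn _ (fun c => uu_mem Θ X Y hX hY _) (fun c => ⟨3, (grassmannExp_uu Θ X Y hX hY _).1⟩)]
  -- the pair product: a sum of hermitian squares of even elements
  have hpair := mul_map_mul_prod_hermSq Θ (N * N) (fun i => grassmannExp (qq Θ X Y (pairOf i)))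
    (fun _ p => ((lamP N p : ℝ) : ℂ)) (fun i p => LL X (pairOf i) ^ (p : ℕ)) (fun i p => LL Y (pairOf i) ^ (p : ℕ))
    (fun _ _ => 0) (fun i => (grassmannExp_qq Θ X Y hX _).2) (fun i p => LL_pow_mem X hX _ _)
    (fun i p => LL_pow_mem Y hY _ _) 1 1
  rw [Θ.map_one, mul_one, one_mul] at hpair
  simp only [one_mul] at hpair
  rw [hpair, Finset.sum_mul]
  -- the single product, for each pair choice
  have hsingle : ∀ f : Fin (N * N) → Fin 3,
      (List.ofFn fun i => LL X (pairOf i) ^ (f i : ℕ)).prod * Θ ((List.ofFn fun i => LL Y (pairOf i) ^ (f i : ℕ)).prod) *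
          (List.ofFn fun c => grassmannExp (uu Θ X Y c)).prod =
        ∑ g : Fin N → Fin 3, (∏ c, ((lamS (g c) : ℝ) : ℂ)) •
          ((List.ofFn fun i => LL X (pairOf i) ^ (f i : ℕ)).prod * (List.ofFn fun c => evalF X (singleF c (g c))).prod *
            Θ ((List.ofFn fun i => LL Y (pairOf i) ^ (f i : ℕ)).prod * (List.ofFn fun c => evalF Y (singleF c (g c))).prod)) := by
    intro f
    refine mul_map_mul_prod_hermSq Θ N (fun c => grassmannExp (uu Θ X Y c)) (fun _ t => ((lamS t : ℝ) : ℂ))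
      (fun c t => evalF X (singleF c t)) (fun c t => evalF Y (singleF c t)) (fun _ t => parS t) (fun c => ?_)
      (fun c t => evalF_singleF_mem X hX c t) (fun c t => evalF_singleF_mem Y hY c t) _ _
    rw [(grassmannExp_uu Θ X Y hX hY c).2, Fin.sum_univ_three]
    simp only [lamS, singleF, Matrix.cons_val_zero, Matrix.cons_val_one, Matrix.cons_val_two, Matrix.head_cons,
      Matrix.tail_cons, evalF, map_one, FreeAlgebra.lift_ι_apply, Θ.map_one, mul_one, bb]
    push_cast
    module
  simp only [smul_mul_assoc, hsingle, Finset.smul_sum, smul_smul]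
  -- the right-hand side, reindexed by `(f, g)`
  rw [Fintype.sum_prod_type]
  refine Finset.sum_congr rfl fun f _ => Finset.sum_congr rfl fun g _ => ?_
  rw [evalF_elem, evalF_elem, lam]
  push_cast
  rfl

/-- **THE ONE-LINK HERMITIAN-SQUARE CERTIFICATE OF THE `U(N)` THEORY AT `κ = 1/4N`, FOR EVERY `N ≥ 1`**:
Salmhofer–Seiler's Remark 4.5 "at `β > 0`" in the matrix form consumed by
`StaggeredGaugeGaussianCorrectedRPOfHermitianSquares.gaussCorrectedN_reflection_positivity`. [cite: SalmhoferSeiler1991, Remark 4.5] -/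
def hermSqCert (hN : N ≠ 0) : HermSqCert N (1 / (4 * N)) (Idx N) where
  lam := lam
  lam_nonneg := lam_nonneg
  elem := elem
  par := par
  homog := elem_homog
  identity := fun _ Θ X Y hX hY => cert_identity Θ X Y hX hY hN

end Identity


end GaussCorrAllColours

end Summit.Ventures.YMGap.Conjectures

end
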